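import Summits.KontsevichZagierPeriods.KontsevichZagierPeriods.Theses.HurwitzMicroSectors
import Summits.KontsevichZagierPeriods.KontsevichZagierPeriods.Theorems.HurwitzMicroSectorsNormalFormPrinciplePiBoxTransfer
import Summits.KontsevichZagierPeriods.KontsevichZagierPeriods.Theorems.HurwitzMicroSectorsNormalFormPrincipleVariants2227

/-! TTRL-lite variant V2248 of stmt-KontsevichZagierPeriods-3869

Variant V2248 = `stub_boxRigidity` (the leaf `BoxRigidity` of `NormalFormPrinciple`: two representations
on open unit boxes with integrands of KZ's rational shape `p/q` over `ℚ` and equal values are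
KZ-equivalent) under the TWO-sided move `fix_nat:m=3; bound_nat:m'≤4` (left dimension frozen to `3`,
right dimension bounded by `4`). Verdict of the attempt seat: **open** — this file is the exact-strength
certificate, not a proof of the variant. For every `K` let `BoxVanishing K` say that a box-rational
representation of dimension `K` and value `0` is a relation. A two-sided move is governed by the LARGEST
dimension it allows, here `4` (on the bounded side): comparing with the zero representation on the
`3`-box gives `BoxVanishing 4` (`boxVanishingDim_right_of_pair`, tree), and conversely `BoxVanishing 4`
gives rigidity for all `m, m' ≤ 4` (pad both representations to the `4`-box and subtract there,
`boxRigidityLe_of_boxVanishingDim`, tree). Hence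

* `stub_boxRigidity_var2248_iff_boxVanishing_four`: V2248 ⟺ **BoxVanishing 4**;
* `stub_boxRigidity_var2248_iff_le_four`: V2248 ⟺ BoxRigidity for ALL `m, m' ≤ 4` — Conjecture 1 of
  Kontsevich–Zagier for every pair of rational integrands on the boxes `(0,1)^{≤4}`; the frozen `3` is
  idle and bounding `m' ≤ 4` is the same as freezing `m' = 4`;
* `stub_boxRigidity_var2248_iff_var2247`: V2248 is literally the sibling V2247 (`(m, m') = (3, 4)`);
* `boxVanishing_le_four_of_stub_boxRigidity_var2248`: V2248 gives `BoxVanishing j` for every `j ≤ 4`, so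
  it contains the square (`BoxVanishing 2`: every vanishing `ℚ`-combination of absolutely convergent
  `∫_{(0,1)²} P/Q` — values `π²`, `log 2`, `π log 2`, Catalan's `G`, `L(2,χ)` … — is generated by the
  four moves; e.g. for `a b : ℚ`, "`a + b·G = 0 ⇒ [a + b/(1+x²y²)]_{(0,1)²}` is a relation", decidable
  today only through the irrationality of `G`, open) and the cube (`BoxVanishing 3`: the
  `ζ(3) ∈ ℚπ³` dichotomy). This is the residual goal; `BoxVanishing 1` is the tree's theorem
  `boxRigidity_of_le_one` (Baker) and dimension `2` is the first open rung;
* `stub_boxRigidity_var2248_of_parent` / `_of_statement`: parent leaf ⇒ V2248 and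
  `KontsevichZagierPeriods ⇒ V2248`, so a refutation of the variant would refute Conjecture 1 for the
  tree's calculus — the variant is neither provable nor refutable from the tree today.

Source: M. Kontsevich, D. Zagier, *Periods* (2001), §1.2 Conjecture 1. Pure proof file, no definitions. -/

-- `Summit.<Summit>.<Problem>` is the tree's mandated summit-side namespace (CONVENTIONS §2); for this
-- single-conjunct summit the two coincide, so the duplicate is deliberate.
set_option linter.dupNamespace false

noncomputable section

namespace Summit.KontsevichZagierPeriods.KontsevichZagierPeriods.Theorems

open MeasureTheory Set
open Literature.NumberTheory.Transcendental Literature.NumberTheory.Transcendental.KZ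
open Summit.KontsevichZagierPeriods.KontsevichZagierPeriods.Theses.HurwitzMicroSectors
open Summit.KontsevichZagierPeriods.HurwitzMicroSectors.NormalFormPrinciple.PiBox

/-! ## The variant V2248 itself: exactly `BoxVanishing 4` -/

/-- **V2248 ⟺ `BoxVanishing 4`**: (⇒) the pair `(3, 4)` is allowed (`4 ≤ 4`), so compare a vanishing
box-rational representation on `(0,1)⁴` with the zero representation on the `3`-box
(`boxVanishingDim_right_of_pair`); (⇐) `boxRigidityLe_of_boxVanishingDim 4` with `m = 3 ≤ 4`, `m' ≤ 4`.
[cite: KontsevichZagier2001, §1.2 Conjecture 1] -/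
theorem stub_boxRigidity_var2248_iff_boxVanishing_four :
    (∀ (m' : ℕ) (N : IntegralRep 3) (N' : IntegralRep m'), m' ≤ 4 → N.domain = {x | ∀ i, x i ∈ Set.Ioo (0:ℝ) 1} → N.IsRational → N'.domain = {x | ∀ i, x i ∈ Set.Ioo (0:ℝ) 1} → N'.IsRational → N.value = N'.value → Equivalent N N') ↔
    (∀ (M : IntegralRep 4), M.domain = {x | ∀ i, x i ∈ Set.Ioo (0:ℝ) 1} → M.IsRational →
      M.value = 0 → of M ∈ relations) :=
  ⟨fun h => boxVanishingDim_right_of_pair 3 4 fun N N' => h 4 N N' le_rfl,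
    fun hvan m' N N' hm' => boxRigidityLe_of_boxVanishingDim 4 hvan 3 m' N N' (by norm_num) hm'⟩

/-- **V2248 ⟺ `BoxRigidity` for all `m, m' ≤ 4`** (the honest strength of the variant: Conjecture 1 for
all pairs of rational integrands on the open unit boxes of dimension at most `4`; so V2248 coincides with
the two-sided variants `bound_nat:m≤4; bound_nat:m'≤4` and `fix_nat:m=j; fix/bound m' k` for every
`max j k = 4`). [cite: KontsevichZagier2001, §1.2 Conjecture 1] -/
theorem stub_boxRigidity_var2248_iff_le_four :
    (∀ (m' : ℕ) (N : IntegralRep 3) (N' : IntegralRep m'), m' ≤ 4 → N.domain = {x | ∀ i, x i ∈ Set.Ioo (0:ℝ) 1} → N.IsRational → N'.domain = {x | ∀ i, x i ∈ Set.Ioo (0:ℝ) 1} → N'.IsRational → N.value = N'.value → Equivalent N N') ↔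
    (∀ (m m' : ℕ) (N : IntegralRep m) (N' : IntegralRep m'), m ≤ 4 → m' ≤ 4 →
      N.domain = {x | ∀ i, x i ∈ Set.Ioo (0:ℝ) 1} → N.IsRational →
      N'.domain = {x | ∀ i, x i ∈ Set.Ioo (0:ℝ) 1} → N'.IsRational →
      N.value = N'.value → Equivalent N N') := by
  rw [stub_boxRigidity_var2248_iff_boxVanishing_four]
  exact ⟨fun hvan => boxRigidityLe_of_boxVanishingDim 4 hvan,
    fun h => boxVanishingDim_left_of_pair 4 4 fun N N' => h 4 4 N N' le_rfl le_rfl⟩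

/-- **V2248 ⟺ the sibling V2247** (`fix_nat:m=3; fix_nat:m'=4`, file `…Variants2247`): both are
`BoxVanishing 4` (`boxRigidityPair_iff_boxVanishingDim_right`, `3 ≤ 4`) — bounding the right dimension
by `4` is exactly as strong as freezing it at `4`.
[cite: KontsevichZagier2001, §1.2 Conjecture 1] -/
theorem stub_boxRigidity_var2248_iff_var2247 :
    (∀ (m' : ℕ) (N : IntegralRep 3) (N' : IntegralRep m'), m' ≤ 4 → N.domain = {x | ∀ i, x i ∈ Set.Ioo (0:ℝ) 1} → N.IsRational → N'.domain = {x | ∀ i, x i ∈ Set.Ioo (0:ℝ) 1} → N'.IsRational → N.value = N'.value → Equivalent N N') ↔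
    (∀ (N : IntegralRep 3) (N' : IntegralRep 4), N.domain = {x | ∀ i, x i ∈ Set.Ioo (0:ℝ) 1} → N.IsRational → N'.domain = {x | ∀ i, x i ∈ Set.Ioo (0:ℝ) 1} → N'.IsRational → N.value = N'.value → Equivalent N N') := by
  rw [stub_boxRigidity_var2248_iff_boxVanishing_four,
    boxRigidityPair_iff_boxVanishingDim_right (show 3 ≤ 4 by norm_num)]

/-- **V2248 ⇒ the sibling V2238** (`fix_nat:m=3; bound_nat:m'≤2`, which is `BoxVanishing 3`): shrinking
the bound only weakens. [cite: KontsevichZagier2001, §1.2 Conjecture 1] -/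
theorem stub_boxRigidity_var2238_of_var2248
    (h : ∀ (m' : ℕ) (N : IntegralRep 3) (N' : IntegralRep m'), m' ≤ 4 → N.domain = {x | ∀ i, x i ∈ Set.Ioo (0:ℝ) 1} → N.IsRational → N'.domain = {x | ∀ i, x i ∈ Set.Ioo (0:ℝ) 1} → N'.IsRational → N.value = N'.value → Equivalent N N') :
    ∀ (m' : ℕ) (N : IntegralRep 3) (N' : IntegralRep m'), m' ≤ 2 → N.domain = {x | ∀ i, x i ∈ Set.Ioo (0:ℝ) 1} → N.IsRational → N'.domain = {x | ∀ i, x i ∈ Set.Ioo (0:ℝ) 1} → N'.IsRational → N.value = N'.value → Equivalent N N' :=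
  fun m' N N' hm' => h m' N N' (hm'.trans (by norm_num))

/-- **V2248 ⇒ `BoxVanishing` in every dimension `≤ 4`** (monotonicity by padding), in particular the
square, which contains Catalan's dichotomy, and the cube. [cite: KontsevichZagier2001, §1.2 Conjecture 1] -/
theorem boxVanishing_le_four_of_stub_boxRigidity_var2248
    (h : ∀ (m' : ℕ) (N : IntegralRep 3) (N' : IntegralRep m'), m' ≤ 4 → N.domain = {x | ∀ i, x i ∈ Set.Ioo (0:ℝ) 1} → N.IsRational → N'.domain = {x | ∀ i, x i ∈ Set.Ioo (0:ℝ) 1} → N'.IsRational → N.value = N'.value → Equivalent N N')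
    {j : ℕ} (hj : j ≤ 4) (N : IntegralRep j) (hNd : N.domain = {x | ∀ i, x i ∈ Set.Ioo (0:ℝ) 1})
    (hNr : N.IsRational) (hv : N.value = 0) : of N ∈ relations :=
  boxVanishingDim_mono hj (stub_boxRigidity_var2248_iff_boxVanishing_four.1 h) N hNd hNr hv

/-! ## V2248 follows from the parent leaf and from the Summit -/

/-- **The parent leaf ⇒ V2248** (specialisation `m := 3`; the converse is not claimed — the parent is
`BoxVanishing` in ALL dimensions). [cite: KontsevichZagier2001, §1.2 Conjecture 1] -/
theorem stub_boxRigidity_var2248_of_parent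
    (h : ∀ (m m' : ℕ) (N : IntegralRep m) (N' : IntegralRep m'), N.domain = {x | ∀ i, x i ∈ Set.Ioo (0:ℝ) 1} → N.IsRational → N'.domain = {x | ∀ i, x i ∈ Set.Ioo (0:ℝ) 1} → N'.IsRational → N.value = N'.value → Equivalent N N') :
    ∀ (m' : ℕ) (N : IntegralRep 3) (N' : IntegralRep m'), m' ≤ 4 → N.domain = {x | ∀ i, x i ∈ Set.Ioo (0:ℝ) 1} → N.IsRational → N'.domain = {x | ∀ i, x i ∈ Set.Ioo (0:ℝ) 1} → N'.IsRational → N.value = N'.value → Equivalent N N' :=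
  fun m' N N' _ => h 3 m' N N'

/-- **`KontsevichZagierPeriods ⇒ V2248`**: the variant is a special case of Conjecture 1 for the tree's
calculus (`leaves_of_statement`) — so a refutation of the variant would refute the Summit.
[cite: KontsevichZagier2001, §1.2 Conjecture 1] -/
theorem stub_boxRigidity_var2248_of_statement (h : _root_.KontsevichZagierPeriods) :
    ∀ (m' : ℕ) (N : IntegralRep 3) (N' : IntegralRep m'), m' ≤ 4 → N.domain = {x | ∀ i, x i ∈ Set.Ioo (0:ℝ) 1} → N.IsRational → N'.domain = {x | ∀ i, x i ∈ Set.Ioo (0:ℝ) 1} → N'.IsRational → N.value = N'.value → Equivalent N N' :=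
  stub_boxRigidity_var2248_of_parent (leaves_of_statement h).1

end Summit.KontsevichZagierPeriods.KontsevichZagierPeriods.Theorems

end
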